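import Summits.CriticalPhenomena.PercolationContinuityZ3.Theorems.PercNearOneGluingNoHeavyLowerTailAntitheticLiftComposition
import Summits.CriticalPhenomena.PercolationContinuityZ3.Theorems.PercNearOneGluingNoHeavyLowerTailAntitheticBlockTools
import Summits.CriticalPhenomena.PercolationContinuityZ3.Theorems.PercNearOneGluingNoHeavyLowerTailAntitheticCutVertex
import HarnessLib

/-!
# `NoHeavyLowerTail` (stmt-CriticalPhenomena-4575) — antithetic cluster pairs: the **1-SUM LEMMA** — every event-restricted 𝒮-positivity
# (⊕-positivity, the mixed sum (M), …) survives hanging an ARBITRARY graph at ONE vertex (prim-hp-2 gen 64, HOME/MEMO-gen64.md §1)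

Support file (`--supports stmt-CriticalPhenomena-4575`, hull-port prover `prim-hp-2`, gen 64).  No definitions, no named facts, no sorries;
standard axioms.  VERTEX version; colourings `ω : Set (Sym2 V)`, `X_E ω = openCluster (ω ∩ E) s` (red cluster), `Y_E ω = openCluster (ωᶜ ∩ E) s`
(blue cluster); 𝒮 = twisted-monotone super-odd `K : Set V → Set V → ℝ` (…AntitheticOneSidedCubes).

SETTING (…AntitheticBlockTools): edge sets `E₁, E₂` (disjoint) GLUED AT ONE VERTEX `a` — a vertex on a pair of `E₁` and on a pair of `E₂`
is `a` (`hsep`) — with the source on the `E₁` side (`hs`: a pair of `E₂` contains `s` only if `s = a`; `s = a` allowed).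
* `Antithetic.OneSum.cluster_eq` — the cluster of `s` in `E₁ ∪ E₂` is `X₁ ∪ {v | a ∈ X₁ ∧ v ∈ C_a(E₂)}` (any colouring; the
  CONDITIONAL LIFT of the `E₂`-cluster of `a`).
* `Antithetic.OneSum.event_sum_nonneg` — **1-SUM LEMMA.**  Let `pred` be any event that only depends on `ω ∩ E₁`.  If
  `Σ_{ω : pred ω} K₁K₂(X_{E₁} ω, Y_{E₁} ω) ≥ 0` for all `K₁, K₂ ∈ 𝒮`, then `Σ_{ω : pred ω} K₁K₂(X_{E₁∪E₂} ω, Y_{E₁∪E₂} ω) ≥ 0` for all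
  `K₁, K₂ ∈ 𝒮`.  PROOF: double the colouring (grafting, as in …AntitheticCutVertex); for a fixed `E₁`-colouring the `E₂`-colourings form
  the red-dominated cube `T ↦ (C_a(T ∩ E₂), C_a(Tᶜ ∩ E₂))` (exactly antipodal) acting by conditional lifts, and
  `Antithetic.lift_composition_filter_nonneg` (Harris in `T` + the cube-averaged test functions are again in 𝒮) applies.  No box, no
  freezing: the hung graph is arbitrary.
* `Antithetic.OneSum.oplus_nonneg` — ⊕-POSITIVITY IS 1-SUM STABLE: `(E₁, s, P)` ⊕-positive, `P` on the `E₁` side ⇒ `(E₁ ∪ E₂, s, P)`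
  ⊕-positive.  `Antithetic.OneSum.mixed_nonneg` — the MIXED SUM (M) `Σ_{P ∈ X, Q ∉ Y} K₁K₂ ≥ 0` is 1-sum stable (`P, Q` on the `E₁` side).
  Consequences (…AntitheticHandleDual): the HANDLE PRINCIPLE needs (⊕) for the base graph only — its stub hypotheses `(⊕_j)` are 1-sums —
  so ⊕-certificates of ANY kind (boxes, checked pair-cube certificates) feed handles of every length.
[cite: VandenbergHaggstromKahn2005, §1 p. 6 ("Harris' inequality"), §1 p. 3 (open cluster `C_s`)]
-/

noncomputable section

namespace Summit.CriticalPhenomena.PercolationContinuityZ3.Theorems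

open Literature.Probability.Percolation
open scoped Classical

namespace Antithetic

namespace OneSum

variable {V : Type*} {E₁ E₂ : Set (Sym2 V)} {s a : V}
  (hsep : ∀ e₁ ∈ E₁, ∀ e₂ ∈ E₂, ∀ v : V, v ∈ e₁ → v ∈ e₂ → v = a) (hs : ∀ e ∈ E₂, s ∈ e → s = a)
include hsep hs

/-- **Clusters of a 1-sum.**  For any colouring `η`, the cluster of `s` in `η ∩ (E₁ ∪ E₂)` is the cluster in `η ∩ E₁` together with — when
that cluster contains the cut vertex `a` — the cluster of `a` in `η ∩ E₂`. [folklore] -/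
theorem cluster_eq (η : Set (Sym2 V)) :
    openCluster (η ∩ (E₁ ∪ E₂)) s =
      openCluster (η ∩ E₁) s ∪ {v | a ∈ openCluster (η ∩ E₁) s ∧ v ∈ openCluster (η ∩ E₂) a} := by
  ext v
  constructor
  · intro hv
    change (openGraph (η ∩ (E₁ ∪ E₂))).Reachable s v at hv
    by_cases hva : ∀ e ∈ E₂, v ∈ e → v = a
    · exact Or.inl ((Glue.reach_side_one s hsep hs hva).1 hv)
    · push Not at hva
      obtain ⟨e, he, hve, hne⟩ := hva
      exact Or.inr ((Glue.reach_side_two s hsep hs hne he hve).1 hv)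
  · rintro (hv | ⟨ha, hv⟩)
    · exact Freeze.openCluster_mono (Set.inter_subset_inter_right _ Set.subset_union_left) s hv
    · have h1 : (openGraph (η ∩ (E₁ ∪ E₂))).Reachable s a :=
        SimpleGraph.Reachable.mono (Glue.le_union_left η E₁ E₂) ha
      have h2 : (openGraph (η ∩ (E₁ ∪ E₂))).Reachable a v :=
        SimpleGraph.Reachable.mono (Glue.le_union_right η E₁ E₂) hv
      exact h1.trans h2

variable [Fintype V]

/-- **1-SUM LEMMA.**  `E₁, E₂` disjoint, glued at the single vertex `a`, source on the `E₁` side; `pred` an event depending only on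
`ω ∩ E₁`.  If `Σ_{ω : pred ω} K₁K₂(X_{E₁} ω, Y_{E₁} ω) ≥ 0` for all twisted-monotone super-odd `K₁, K₂`, then the same holds with the clusters
of `E₁ ∪ E₂`. [this work] -/
theorem event_sum_nonneg (hdis : Disjoint E₁ E₂) (pred : Set (Sym2 V) → Prop) [DecidablePred pred]
    (hpred : ∀ ω ω' : Set (Sym2 V), ω ∩ E₁ = ω' ∩ E₁ → (pred ω ↔ pred ω'))
    (hplus : ∀ K₁ K₂ : Set V → Set V → ℝ,
      (∀ ⦃P P' Q Q' : Set V⦄, P ⊆ P' → Q' ⊆ Q → K₁ P Q ≤ K₁ P' Q') → (∀ P Q, 0 ≤ K₁ P Q + K₁ Q P) →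
      (∀ ⦃P P' Q Q' : Set V⦄, P ⊆ P' → Q' ⊆ Q → K₂ P Q ≤ K₂ P' Q') → (∀ P Q, 0 ≤ K₂ P Q + K₂ Q P) →
      0 ≤ ∑ ω ∈ Finset.univ.filter (fun ω : Set (Sym2 V) => pred ω),
        K₁ (openCluster (ω ∩ E₁) s) (openCluster (ωᶜ ∩ E₁) s) * K₂ (openCluster (ω ∩ E₁) s) (openCluster (ωᶜ ∩ E₁) s))
    (K₁ K₂ : Set V → Set V → ℝ)
    (hK₁ : ∀ ⦃P P' Q Q' : Set V⦄, P ⊆ P' → Q' ⊆ Q → K₁ P Q ≤ K₁ P' Q') (hso₁ : ∀ P Q, 0 ≤ K₁ P Q + K₁ Q P)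
    (hK₂ : ∀ ⦃P P' Q Q' : Set V⦄, P ⊆ P' → Q' ⊆ Q → K₂ P Q ≤ K₂ P' Q') (hso₂ : ∀ P Q, 0 ≤ K₂ P Q + K₂ Q P) :
    0 ≤ ∑ ω ∈ Finset.univ.filter (fun ω : Set (Sym2 V) => pred ω),
      K₁ (openCluster (ω ∩ (E₁ ∪ E₂)) s) (openCluster (ωᶜ ∩ (E₁ ∪ E₂)) s) *
        K₂ (openCluster (ω ∩ (E₁ ∪ E₂)) s) (openCluster (ωᶜ ∩ (E₁ ∪ E₂)) s) := by
  -- notation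
  let X₁ : Set (Sym2 V) → Set V := fun ω => openCluster (ω ∩ E₁) s
  let Y₁ : Set (Sym2 V) → Set V := fun ω => openCluster (ωᶜ ∩ E₁) s
  let A : Set (Sym2 V) → Set V := fun ω => openCluster (ω ∩ E₂) a
  let B : Set (Sym2 V) → Set V := fun ω => openCluster (ωᶜ ∩ E₂) a
  let L : Set V → Set V → Set V := fun P S => P ∪ {u | a ∈ P ∧ u ∈ S}
  let KK : Set V → Set V → ℝ := fun P Q => K₁ P Q * K₂ P Q
  let Ψ₂ : Set (Sym2 V) → Set (Sym2 V) → ℝ := fun ω₁ ω₂ =>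
    if pred ω₁ then KK (L (X₁ ω₁) (A ω₂)) (L (Y₁ ω₁) (B ω₂)) else 0
  have hdis' : ∀ e, e ∈ E₁ → e ∉ E₂ := fun e h1 h2 => Set.disjoint_left.1 hdis h1 h2
  -- (1) the target is the diagonal of `Ψ₂`
  have hdiag : ∑ ω ∈ Finset.univ.filter (fun ω : Set (Sym2 V) => pred ω),
      K₁ (openCluster (ω ∩ (E₁ ∪ E₂)) s) (openCluster (ωᶜ ∩ (E₁ ∪ E₂)) s) *
        K₂ (openCluster (ω ∩ (E₁ ∪ E₂)) s) (openCluster (ωᶜ ∩ (E₁ ∪ E₂)) s) = ∑ ω, Ψ₂ ω ω := by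
    rw [Finset.sum_filter]
    refine Finset.sum_congr rfl fun ω _ => ?_
    have e1 : openCluster (ω ∩ (E₁ ∪ E₂)) s = L (X₁ ω) (A ω) := cluster_eq hsep hs ω
    have e2 : openCluster (ωᶜ ∩ (E₁ ∪ E₂)) s = L (Y₁ ω) (B ω) := cluster_eq hsep hs ωᶜ
    rw [e1, e2]
  -- (2) grafting: the double sum is `|Set (Sym2 V)|` times the diagonal
  let θ : Set (Sym2 V) × Set (Sym2 V) → Set (Sym2 V) × Set (Sym2 V) :=
    fun p => ((p.1 \ E₂) ∪ (p.2 ∩ E₂), (p.2 \ E₂) ∪ (p.1 ∩ E₂))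
  have hθ : Function.Involutive θ := fun p => Cut.graft_graft E₂ p
  have g1 : ∀ c d : Set (Sym2 V), ((c \ E₂) ∪ (d ∩ E₂)) ∩ E₁ = c ∩ E₁ := by
    intro c d; ext e
    simp only [Set.mem_inter_iff, Set.mem_union, Set.mem_sdiff]
    constructor
    · rintro ⟨h | h, he⟩
      · exact ⟨h.1, he⟩
      · exact absurd h.2 (hdis' e he)
    · rintro ⟨hc, he⟩; exact ⟨Or.inl ⟨hc, hdis' e he⟩, he⟩
  have g2 : ∀ c d : Set (Sym2 V), ((c \ E₂) ∪ (d ∩ E₂))ᶜ ∩ E₁ = cᶜ ∩ E₁ := by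
    intro c d; ext e
    simp only [Set.mem_inter_iff, Set.mem_compl_iff, Set.mem_union, Set.mem_sdiff, not_or, not_and, not_not]
    constructor
    · rintro ⟨⟨h1, _⟩, he⟩; exact ⟨fun hc => hdis' e he (h1 hc), he⟩
    · rintro ⟨hc, he⟩; exact ⟨⟨fun hc' => absurd hc' hc, fun _ he2 => absurd he2 (hdis' e he)⟩, he⟩
  have hΨθ : ∀ p : Set (Sym2 V) × Set (Sym2 V), Ψ₂ p.1 p.2 = Ψ₂ (θ p).1 (θ p).1 := by
    intro p
    have a0 : pred (θ p).1 ↔ pred p.1 := hpred _ _ (g1 p.1 p.2)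
    have a1 : X₁ (θ p).1 = X₁ p.1 := by show openCluster (((p.1 \ E₂) ∪ (p.2 ∩ E₂)) ∩ E₁) s = _; rw [g1]
    have a2 : Y₁ (θ p).1 = Y₁ p.1 := by show openCluster (((p.1 \ E₂) ∪ (p.2 ∩ E₂))ᶜ ∩ E₁) s = _; rw [g2]
    have a3 : A (θ p).1 = A p.2 := by
      show openCluster (((p.1 \ E₂) ∪ (p.2 ∩ E₂)) ∩ E₂) a = _; rw [(Cut.graft_inter_right p.1 p.2).1]
    have a4 : B (θ p).1 = B p.2 := by
      show openCluster (((p.1 \ E₂) ∪ (p.2 ∩ E₂))ᶜ ∩ E₂) a = _; rw [(Cut.graft_inter_right p.1 p.2).2]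
    simp only [Ψ₂, a0, a1, a2, a3, a4]
  have hrel : ∑ ω₁, ∑ ω₂, Ψ₂ ω₁ ω₂ = (Fintype.card (Set (Sym2 V)) : ℝ) * ∑ ω, Ψ₂ ω ω := by
    rw [← Fintype.sum_prod_type']
    rw [show ∑ p : Set (Sym2 V) × Set (Sym2 V), Ψ₂ p.1 p.2 = ∑ p : Set (Sym2 V) × Set (Sym2 V), Ψ₂ (θ p).1 (θ p).1 from
      Fintype.sum_congr _ _ hΨθ]
    rw [Fintype.sum_bijective θ hθ.bijective (fun p => Ψ₂ (θ p).1 (θ p).1) (fun q => Ψ₂ q.1 q.1) (fun p => rfl)]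
    rw [Fintype.sum_prod_type, Finset.mul_sum]
    refine Finset.sum_congr rfl fun c _ => ?_
    show ∑ _d : Set (Sym2 V), Ψ₂ c c = _
    rw [Finset.sum_const, Finset.card_univ, nsmul_eq_mul]
  -- (3) the double sum is nonnegative: lift composition over the (exactly antipodal) cluster cube of `a` in `E₂`
  have hdbl : 0 ≤ ∑ ω₁, ∑ ω₂, Ψ₂ ω₁ ω₂ := by
    have hΦ : ∀ ω₁, ∑ ω₂, Ψ₂ ω₁ ω₂ =
        if pred ω₁ then ∑ ω₂, KK (L (X₁ ω₁) (A ω₂)) (L (Y₁ ω₁) (B ω₂)) else 0 := by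
      intro ω₁
      by_cases h : pred ω₁
      · simp only [Ψ₂, h, if_true]
      · simp only [Ψ₂, h, if_false, Finset.sum_const_zero]
    simp_rw [hΦ]
    rw [← Finset.sum_filter]
    refine lift_composition_filter_nonneg pred X₁ Y₁ hplus (fun T P => L P (A T)) (fun T Q => L Q (B T))
      ?_ ?_ ?_ ?_ ?_ hK₁ hso₁ hK₂ hso₂
    · -- monotone in the set
      intro T P P' hP u hu
      rcases hu with hu | ⟨ha, hu⟩
      · exact Or.inl (hP hu)
      · exact Or.inr ⟨hP ha, hu⟩
    · intro T Q Q' hQ u hu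
      rcases hu with hu | ⟨ha, hu⟩
      · exact Or.inl (hQ hu)
      · exact Or.inr ⟨hQ ha, hu⟩
    · -- `Φ` monotone in `T`
      intro P T T' hTT' u hu
      rcases hu with hu | ⟨ha, hu⟩
      · exact Or.inl hu
      · exact Or.inr ⟨ha, Freeze.openCluster_mono (Set.inter_subset_inter_left E₂ hTT') a hu⟩
    · -- `Ψ` antitone in `T`
      intro Q T T' hTT' u hu
      rcases hu with hu | ⟨ha, hu⟩
      · exact Or.inl hu
      · exact Or.inr ⟨ha, Freeze.openCluster_mono (Set.inter_subset_inter_left E₂ (Set.compl_subset_compl.2 hTT')) a hu⟩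
    · -- antipodal domination (with equality: `B Tᶜ = A T`)
      intro T P u hu
      rcases hu with hu | ⟨ha, hu⟩
      · exact Or.inl hu
      · refine Or.inr ⟨ha, ?_⟩
        have : B Tᶜ = A T := by show openCluster (Tᶜᶜ ∩ E₂) a = openCluster (T ∩ E₂) a; rw [compl_compl]
        rw [← this]; exact hu
  -- (4) conclude
  rw [hdiag]
  have hN : (0 : ℝ) < (Fintype.card (Set (Sym2 V)) : ℝ) := by exact_mod_cast Fintype.card_pos
  rw [hrel] at hdbl
  exact (mul_nonneg_iff_of_pos_left hN).1 hdbl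

/-- **⊕-positivity is 1-sum stable.**  `P` a vertex of the `E₁` side (on a pair of `E₂` only if `P = a`).  If `(E₁, s, P)` is ⊕-positive —
`Σ_{ω : P ∈ X_{E₁} ω} K₁K₂(X_{E₁} ω, Y_{E₁} ω) ≥ 0` for all `K₁, K₂ ∈ 𝒮` — then so is `(E₁ ∪ E₂, s, P)`. [this work] -/
theorem oplus_nonneg (hdis : Disjoint E₁ E₂) {P : V} (hP : ∀ e ∈ E₂, P ∈ e → P = a)
    (hplus : ∀ K₁ K₂ : Set V → Set V → ℝ,
      (∀ ⦃A A' B B' : Set V⦄, A ⊆ A' → B' ⊆ B → K₁ A B ≤ K₁ A' B') → (∀ A B, 0 ≤ K₁ A B + K₁ B A) →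
      (∀ ⦃A A' B B' : Set V⦄, A ⊆ A' → B' ⊆ B → K₂ A B ≤ K₂ A' B') → (∀ A B, 0 ≤ K₂ A B + K₂ B A) →
      0 ≤ ∑ ω ∈ Finset.univ.filter (fun ω : Set (Sym2 V) => P ∈ openCluster (ω ∩ E₁) s),
        K₁ (openCluster (ω ∩ E₁) s) (openCluster (ωᶜ ∩ E₁) s) * K₂ (openCluster (ω ∩ E₁) s) (openCluster (ωᶜ ∩ E₁) s))
    (K₁ K₂ : Set V → Set V → ℝ)
    (hK₁ : ∀ ⦃A A' B B' : Set V⦄, A ⊆ A' → B' ⊆ B → K₁ A B ≤ K₁ A' B') (hso₁ : ∀ A B, 0 ≤ K₁ A B + K₁ B A)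
    (hK₂ : ∀ ⦃A A' B B' : Set V⦄, A ⊆ A' → B' ⊆ B → K₂ A B ≤ K₂ A' B') (hso₂ : ∀ A B, 0 ≤ K₂ A B + K₂ B A) :
    0 ≤ ∑ ω ∈ Finset.univ.filter (fun ω : Set (Sym2 V) => P ∈ openCluster (ω ∩ (E₁ ∪ E₂)) s),
      K₁ (openCluster (ω ∩ (E₁ ∪ E₂)) s) (openCluster (ωᶜ ∩ (E₁ ∪ E₂)) s) *
        K₂ (openCluster (ω ∩ (E₁ ∪ E₂)) s) (openCluster (ωᶜ ∩ (E₁ ∪ E₂)) s) := by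
  -- the event `P ∈ X` is the same for `E₁` and `E₁ ∪ E₂` (`P` on the `E₁` side)
  have hev : ∀ ω : Set (Sym2 V), P ∈ openCluster (ω ∩ (E₁ ∪ E₂)) s ↔ P ∈ openCluster (ω ∩ E₁) s :=
    fun ω => Glue.reach_side_one s hsep hs hP
  have hfilter : Finset.univ.filter (fun ω : Set (Sym2 V) => P ∈ openCluster (ω ∩ (E₁ ∪ E₂)) s) =
      Finset.univ.filter (fun ω : Set (Sym2 V) => P ∈ openCluster (ω ∩ E₁) s) :=
    Finset.filter_congr fun ω _ => hev ω
  rw [hfilter]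
  refine event_sum_nonneg hsep hs hdis (fun ω => P ∈ openCluster (ω ∩ E₁) s) ?_ hplus K₁ K₂ hK₁ hso₁ hK₂ hso₂
  intro ω ω' h
  show P ∈ openCluster (ω ∩ E₁) s ↔ P ∈ openCluster (ω' ∩ E₁) s
  rw [h]

/-- **The mixed sum (M) is 1-sum stable.**  `P, Q` on the `E₁` side.  If `Σ_{ω : P ∈ X_{E₁} ω, Q ∉ Y_{E₁} ω} K₁K₂ ≥ 0` for all
`K₁, K₂ ∈ 𝒮`, then the same holds with the clusters of `E₁ ∪ E₂`. [this work] -/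
theorem mixed_nonneg (hdis : Disjoint E₁ E₂) {P Q : V} (hP : ∀ e ∈ E₂, P ∈ e → P = a) (hQ : ∀ e ∈ E₂, Q ∈ e → Q = a)
    (hmixed : ∀ K₁ K₂ : Set V → Set V → ℝ,
      (∀ ⦃A A' B B' : Set V⦄, A ⊆ A' → B' ⊆ B → K₁ A B ≤ K₁ A' B') → (∀ A B, 0 ≤ K₁ A B + K₁ B A) →
      (∀ ⦃A A' B B' : Set V⦄, A ⊆ A' → B' ⊆ B → K₂ A B ≤ K₂ A' B') → (∀ A B, 0 ≤ K₂ A B + K₂ B A) →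
      0 ≤ ∑ ω ∈ Finset.univ.filter (fun ω : Set (Sym2 V) =>
          P ∈ openCluster (ω ∩ E₁) s ∧ Q ∉ openCluster (ωᶜ ∩ E₁) s),
        K₁ (openCluster (ω ∩ E₁) s) (openCluster (ωᶜ ∩ E₁) s) * K₂ (openCluster (ω ∩ E₁) s) (openCluster (ωᶜ ∩ E₁) s))
    (K₁ K₂ : Set V → Set V → ℝ)
    (hK₁ : ∀ ⦃A A' B B' : Set V⦄, A ⊆ A' → B' ⊆ B → K₁ A B ≤ K₁ A' B') (hso₁ : ∀ A B, 0 ≤ K₁ A B + K₁ B A)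
    (hK₂ : ∀ ⦃A A' B B' : Set V⦄, A ⊆ A' → B' ⊆ B → K₂ A B ≤ K₂ A' B') (hso₂ : ∀ A B, 0 ≤ K₂ A B + K₂ B A) :
    0 ≤ ∑ ω ∈ Finset.univ.filter (fun ω : Set (Sym2 V) =>
        P ∈ openCluster (ω ∩ (E₁ ∪ E₂)) s ∧ Q ∉ openCluster (ωᶜ ∩ (E₁ ∪ E₂)) s),
      K₁ (openCluster (ω ∩ (E₁ ∪ E₂)) s) (openCluster (ωᶜ ∩ (E₁ ∪ E₂)) s) *
        K₂ (openCluster (ω ∩ (E₁ ∪ E₂)) s) (openCluster (ωᶜ ∩ (E₁ ∪ E₂)) s) := by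
  have hevP : ∀ ω : Set (Sym2 V), P ∈ openCluster (ω ∩ (E₁ ∪ E₂)) s ↔ P ∈ openCluster (ω ∩ E₁) s :=
    fun ω => Glue.reach_side_one s hsep hs hP
  have hevQ : ∀ ω : Set (Sym2 V), Q ∈ openCluster (ωᶜ ∩ (E₁ ∪ E₂)) s ↔ Q ∈ openCluster (ωᶜ ∩ E₁) s :=
    fun ω => Glue.reach_side_one s hsep hs hQ
  have hfilter : Finset.univ.filter (fun ω : Set (Sym2 V) =>
        P ∈ openCluster (ω ∩ (E₁ ∪ E₂)) s ∧ Q ∉ openCluster (ωᶜ ∩ (E₁ ∪ E₂)) s) =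
      Finset.univ.filter (fun ω : Set (Sym2 V) => P ∈ openCluster (ω ∩ E₁) s ∧ Q ∉ openCluster (ωᶜ ∩ E₁) s) :=
    Finset.filter_congr fun ω _ => by rw [hevP ω, hevQ ω]
  rw [hfilter]
  refine event_sum_nonneg hsep hs hdis (fun ω => P ∈ openCluster (ω ∩ E₁) s ∧ Q ∉ openCluster (ωᶜ ∩ E₁) s) ?_ hmixed
    K₁ K₂ hK₁ hso₁ hK₂ hso₂
  intro ω ω' h
  have h' : ωᶜ ∩ E₁ = ω'ᶜ ∩ E₁ := by
    ext e
    simp only [Set.mem_inter_iff, Set.mem_compl_iff]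
    constructor
    · rintro ⟨h1, he⟩
      exact ⟨fun h2 => h1 (by have : e ∈ ω' ∩ E₁ := ⟨h2, he⟩; rw [← h] at this; exact this.1), he⟩
    · rintro ⟨h1, he⟩
      exact ⟨fun h2 => h1 (by have : e ∈ ω ∩ E₁ := ⟨h2, he⟩; rw [h] at this; exact this.1), he⟩
  show P ∈ openCluster (ω ∩ E₁) s ∧ Q ∉ openCluster (ωᶜ ∩ E₁) s ↔ P ∈ openCluster (ω' ∩ E₁) s ∧ Q ∉ openCluster (ω'ᶜ ∩ E₁) s
  rw [h, h']

end OneSum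

end Antithetic

end Summit.CriticalPhenomena.PercolationContinuityZ3.Theorems
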